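import Literature.NumberTheory.EllipticCurves.EisensteinWeightOneRowContinuation
import Mathlib.Analysis.SpecialFunctions.Trigonometric.Cotangent
import Mathlib.Analysis.Normed.Group.Tannery
import HarnessLib

/-!
# Hecke's limit formula `lim_{σ → 0⁺} ∑_{δ ∈ ℤ} (x + δ)⁻¹ |x + δ|^{-2σ} = π cot(πx)`

Topic `Literature/NumberTheory/EllipticCurves`; namespace
`Literature.NumberTheory.EllipticCurves.ModularForms`; theorems only (no definition, no named fact).

For `Im x > 0` the lattice sum `∑_{δ ∈ ℤ} (x + δ)⁻¹` converges only conditionally; Hecke's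
convergence factor `|x + δ|^{-2σ}`, `σ > 0`, makes it absolutely convergent, and

  `lim_{σ → 0⁺} ∑_{δ ∈ ℤ} (x + δ)⁻¹ |x + δ|^{-2σ} = π cot(πx) = -πi - 2πi ∑_{m ≥ 1} e^{2πimx}`

(`tendsto_tsum_rowKernel_int_nhdsGT_zero`; Hecke 1927, §2; Schoeneberg, *Elliptic Modular
Functions*, VII §2 (14); this is the computation behind the constant and the `q`-expansion of the
weight-one — and weight-two — Eisenstein series). In the notation of
`EisensteinWeightOneRowKernel.lean` the summand is `k(x, σ; δ) = (δ+x)^{-1-σ}(δ+x̄)^{-σ}`. Proof: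

* `rowKernel_ofReal_eq` — for real `σ`, `k(x, σ; t) = (t+x)⁻¹ · |t+x|^{-2σ}` with a REAL second
  factor; `rowKernel_zero_right` — `k(x, 0; t) = (t+x)⁻¹`; `tendsto_rowKernel_nhds_zero` —
  continuity in `σ`;
* pairing `δ ↔ -δ` (Mathlib `HasSum.nat_add_neg`):
  `∑_{n ∈ ℕ} [k(n) + k(-n)] = ∑_{δ ∈ ℤ} k(δ) + k(0)`;
* `norm_rowKernel_pair_le` — **the domination** `‖k(x,σ;n) + k(x,σ;-n)‖ ≤ K(x)/(n+1)²` uniformly in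
  `σ ∈ (0, 1]`: with `a = |x+n|`, `b = |x-n|`,
  `k(n) + k(-n) = [x(a^{-2σ} + b^{-2σ}) - n(a^{-2σ} - b^{-2σ})]/(x² - n²)` and
  `|a^{-2σ} - b^{-2σ}| ≤ 2σ |a - b| min(a,b)^{-2σ-1} ≤ 4|x| min(a,b)^{-2σ-1}` (mean value theorem,
  `abs_rpow_sub_rpow_le`);
* Tannery's theorem (`tendsto_tsum_of_dominated_convergence`) and Mathlib's partial fractions of the
  cotangent `cot_series_rep`: `∑_{n ∈ ℕ} [(x+n)⁻¹ + (x-n)⁻¹] = π cot(πx) + x⁻¹`.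

Then, for the rows of `EisensteinWeightOneRowContinuation.lean` with a `P`-periodic weight `χ` of
mean zero: splitting `∑_{d ∈ ℤ}` into the classes `d = r + Pδ` (`tsum_int_eq_sum_tsum_classes`) and
scaling `k(w, s; r + Pδ) = P^{-1-2s} k((w+r)/P, s; δ)` (`rowKernel_class_eq`) give
`R(χ, w, s) = ∑_{r mod P} χ(r) P^{-1-2s} ∑_δ k((w+r)/P, s; δ)` for `Re s > 0`
(`rowSum_eq_sum_classes`), whence, by `R = R̃` there and the continuity of the continued row `R̃`
at `s = 0`, **the value of the continued row**

  `R̃(χ, w, 0) = ∑_{r mod P} χ(r) (π/P) cot(π (w + r)/P)`        (`rowCont_zero_eq`).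

## References

* E. Hecke, *Theorie der Eisensteinschen Reihen höherer Stufe…*, Abh. Math. Sem. Hamburg 5 (1927),
  §2.
* B. Schoeneberg, *Elliptic Modular Functions*, Springer (1974), Ch. VII §2.
-/

noncomputable section

open Complex Real Set Filter
open scoped ComplexConjugate Topology
open Literature.NumberTheory.LFunctions

namespace Literature.NumberTheory.EllipticCurves.ModularForms

/-! ### A mean value bound for real powers -/

/-- **Mean value bound**: `|b^p - a^p| ≤ |p| a^{p-1} (b - a)` for `0 < a ≤ b` and `p ≤ 1`
(the derivative `p r^{p-1}` has absolute value at most `|p| a^{p-1}` on `[a, b]`). [folklore] -/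
theorem abs_rpow_sub_rpow_le {a b p : ℝ} (ha : 0 < a) (hab : a ≤ b) (hp : p ≤ 1) :
    |b ^ p - a ^ p| ≤ |p| * a ^ (p - 1) * (b - a) := by
  have hderiv : ∀ r ∈ Icc a b, HasDerivWithinAt (fun r : ℝ ↦ r ^ p) (p * r ^ (p - 1)) (Icc a b) r :=
    fun r hr ↦ (Real.hasDerivAt_rpow_const (Or.inl (ha.trans_le hr.1).ne')).hasDerivWithinAt
  have hbound : ∀ r ∈ Ico a b, ‖p * r ^ (p - 1)‖ ≤ |p| * a ^ (p - 1) := by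
    intro r hr
    rw [Real.norm_eq_abs, abs_mul, abs_of_nonneg (Real.rpow_nonneg (ha.le.trans hr.1) _)]
    exact mul_le_mul_of_nonneg_left (Real.rpow_le_rpow_of_nonpos ha hr.1 (by linarith))
      (abs_nonneg _)
  have h := norm_image_sub_le_of_norm_deriv_le_segment' hderiv hbound b (right_mem_Icc.mpr hab)
  rwa [Real.norm_eq_abs] at h

/-! ### The kernel at real `σ` -/

section RealSigma

variable {x : ℂ} (hx : 0 < x.im)
include hx

/-- For real `σ`: `k(x, σ; t) = (t + x)⁻¹ · |t + x|^{-2σ}` (real power). [folklore] -/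
theorem rowKernel_ofReal_eq (σ t : ℝ) :
    rowKernel x σ t = ((t : ℂ) + x)⁻¹ * ((‖(t : ℂ) + x‖ ^ (-2 * σ) : ℝ) : ℂ) := by
  rw [rowKernel_eq_inv_mul_normSq_cpow hx]
  congr 1
  have hL : 0 ≤ ‖(t : ℂ) + x‖ := norm_nonneg _
  rw [show (-(σ : ℂ)) = ((-σ : ℝ) : ℂ) by push_cast; ring, ← ofReal_cpow (by positivity),
    ← Real.rpow_natCast, ← Real.rpow_mul hL]
  norm_num

/-- For real `σ`: `‖k(x, σ; t)‖ = |t + x|^{-1-2σ}`. [folklore] -/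
theorem norm_rowKernel_ofReal (σ t : ℝ) : ‖rowKernel x σ t‖ = ‖(t : ℂ) + x‖ ^ (-1 - 2 * σ) := by
  have hL : 0 < ‖(t : ℂ) + x‖ := norm_pos_iff.mpr (ofReal_add_ne_zero hx t)
  rw [rowKernel_ofReal_eq hx, norm_mul, norm_inv, Complex.norm_real,
    Real.norm_of_nonneg (Real.rpow_nonneg hL.le _), ← Real.rpow_neg_one,
    ← Real.rpow_add hL]
  ring_nf

/-- `k(x, 0; t) = (t + x)⁻¹`. [folklore] -/
theorem rowKernel_zero_right (t : ℝ) : rowKernel x 0 t = ((t : ℂ) + x)⁻¹ := by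
  have := rowKernel_ofReal_eq hx 0 t
  simp only [ofReal_zero, mul_zero, Real.rpow_zero, ofReal_one, mul_one] at this
  exact this

/-- `σ ↦ k(x, σ; t)` tends to `(t + x)⁻¹` as `σ → 0` (it is continuous). [folklore] -/
theorem tendsto_rowKernel_nhds_zero (t : ℝ) :
    Tendsto (fun σ : ℝ ↦ rowKernel x σ t) (𝓝 0) (𝓝 ((t : ℂ) + x)⁻¹) := by
  have hc : Continuous fun s : ℂ ↦ rowKernel x s t := (differentiable_rowKernel_s hx t).continuous
  have h := (hc.comp continuous_ofReal).tendsto 0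
  simp only [Function.comp_apply, ofReal_zero, rowKernel_zero_right hx] at h
  exact h

/-- The uniform bound `a^{-2σ} ≤ 1 + (Im x)⁻²` for `a ≥ Im x`, `σ ∈ [0, 1]`. [folklore] -/
theorem rpow_neg_two_mul_le {a σ : ℝ} (haη : x.im ≤ a) (hσ0 : 0 ≤ σ) (hσ1 : σ ≤ 1) :
    a ^ (-2 * σ) ≤ 1 + (x.im ^ 2)⁻¹ := by
  have ha : 0 < a := hx.trans_le haη
  rcases le_or_gt 1 a with h1 | h1
  · have : a ^ (-2 * σ) ≤ a ^ (0 : ℝ) := Real.rpow_le_rpow_of_exponent_le h1 (by nlinarith)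
    rw [Real.rpow_zero] at this
    linarith [inv_nonneg.mpr (sq_nonneg x.im)]
  · have h2 : a ^ (-2 * σ) ≤ a ^ (-2 : ℝ) :=
      Real.rpow_le_rpow_of_exponent_ge ha h1.le (by nlinarith)
    have h3 : a ^ (-2 : ℝ) ≤ (x.im ^ 2)⁻¹ := by
      rw [Real.rpow_neg ha.le, Real.rpow_two]
      exact inv_anti₀ (by positivity) (by nlinarith)
    linarith

/-- `|t + x| ≥ Im x`. [folklore] -/
theorem im_le_norm_ofReal_add (t : ℝ) : x.im ≤ ‖(t : ℂ) + x‖ := by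
  have := abs_im_le_norm ((t : ℂ) + x)
  simpa [abs_of_pos hx] using this

/-- The crude bound `‖k(x, σ; t)‖ ≤ (Im x)⁻¹ (1 + (Im x)⁻²)` for `σ ∈ [0, 1]`. [folklore] -/
theorem norm_rowKernel_ofReal_le {σ : ℝ} (hσ0 : 0 ≤ σ) (hσ1 : σ ≤ 1) (t : ℝ) :
    ‖rowKernel x σ t‖ ≤ x.im⁻¹ * (1 + (x.im ^ 2)⁻¹) := by
  have hL : 0 < ‖(t : ℂ) + x‖ := norm_pos_iff.mpr (ofReal_add_ne_zero hx t)
  rw [norm_rowKernel_ofReal hx, show (-1 - 2 * σ) = (-1) + (-2 * σ) by ring, Real.rpow_add hL,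
    Real.rpow_neg_one]
  exact mul_le_mul (inv_anti₀ hx (im_le_norm_ofReal_add hx t))
    (rpow_neg_two_mul_le hx (im_le_norm_ofReal_add hx t) hσ0 hσ1) (Real.rpow_nonneg hL.le _)
    (inv_nonneg.mpr hx.le)

/-! ### The domination of the pairs `k(n) + k(-n)` -/

/-- The pair in closed form: with `α = |x+n|^{-2σ}`, `β = |x-n|^{-2σ}` (reals),
`k(n) + k(-n) = (x(α + β) - n(α - β))/(x² - n²)`. [folklore] -/
theorem rowKernel_pair_eq (σ : ℝ) (n : ℕ) :
    rowKernel x σ n + rowKernel x σ (-(n : ℝ)) =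
      (x * ((‖(n : ℂ) + x‖ ^ (-2 * σ) : ℝ) + (‖(-(n : ℂ)) + x‖ ^ (-2 * σ) : ℝ)) -
        n * ((‖(n : ℂ) + x‖ ^ (-2 * σ) : ℝ) - (‖(-(n : ℂ)) + x‖ ^ (-2 * σ) : ℝ))) /
        (x ^ 2 - (n : ℂ) ^ 2) := by
  have h1 := rowKernel_ofReal_eq hx σ n
  have h2 := rowKernel_ofReal_eq hx σ (-(n : ℝ))
  rw [ofReal_natCast] at h1
  rw [ofReal_neg, ofReal_natCast] at h2
  rw [h1, h2]
  have hA : (n : ℂ) + x ≠ 0 := by simpa using ofReal_add_ne_zero hx n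
  have hB : -(n : ℂ) + x ≠ 0 := by simpa using ofReal_add_ne_zero hx (-(n : ℝ))
  have hAB : x ^ 2 - (n : ℂ) ^ 2 ≠ 0 := by
    have : x ^ 2 - (n : ℂ) ^ 2 = ((n : ℂ) + x) * (-(n : ℂ) + x) := by ring
    rw [this]; exact mul_ne_zero hA hB
  field_simp
  ring

/-- **Domination of the pairs**: there is `K` with `‖k(x,σ;n) + k(x,σ;-n)‖ ≤ K/(n+1)²` for all
`n ∈ ℕ` and all `σ ∈ (0, 1]`. [folklore] -/
theorem norm_rowKernel_pair_le :
    ∃ K : ℝ, ∀ σ : ℝ, 0 ≤ σ → σ ≤ 1 → ∀ n : ℕ,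
      ‖rowKernel x σ n + rowKernel x σ (-(n : ℝ))‖ ≤ K / ((n : ℝ) + 1) ^ 2 := by
  set η : ℝ := x.im with hη
  have hη0 : 0 < η := hx
  set M₀ : ℝ := 1 + (η ^ 2)⁻¹ with hM₀
  have hM₀1 : 1 ≤ M₀ := by rw [hM₀]; linarith [inv_nonneg.mpr (sq_nonneg η)]
  set N₀ : ℝ := 2 * ‖x‖ + 2 with hN₀
  have hN₀0 : 0 < N₀ := by rw [hN₀]; positivity
  -- the constant
  refine ⟨160 * ‖x‖ * M₀ + 2 * η⁻¹ * M₀ * (N₀ + 1) ^ 2, fun σ hσ0 hσ1 n ↦ ?_⟩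
  have hK1 : 0 ≤ 160 * ‖x‖ * M₀ := by positivity
  have hK2 : 0 ≤ 2 * η⁻¹ * M₀ * (N₀ + 1) ^ 2 := by positivity
  have hn1 : (0 : ℝ) < (n : ℝ) + 1 := by positivity
  rcases lt_or_ge (n : ℝ) N₀ with hsmall | hlarge
  · -- small `n`: the crude bound
    have hc : ‖rowKernel x σ n + rowKernel x σ (-(n : ℝ))‖ ≤ 2 * η⁻¹ * M₀ := by
      calc _ ≤ ‖rowKernel x σ n‖ + ‖rowKernel x σ (-(n : ℝ))‖ := norm_add_le _ _
        _ ≤ η⁻¹ * M₀ + η⁻¹ * M₀ :=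
            add_le_add (norm_rowKernel_ofReal_le hx hσ0 hσ1 _)
              (norm_rowKernel_ofReal_le hx hσ0 hσ1 _)
        _ = 2 * η⁻¹ * M₀ := by ring
    have hsq : ((n : ℝ) + 1) ^ 2 ≤ (N₀ + 1) ^ 2 := by nlinarith
    rw [le_div_iff₀ (by positivity)]
    calc ‖rowKernel x σ n + rowKernel x σ (-(n : ℝ))‖ * ((n : ℝ) + 1) ^ 2
        ≤ (2 * η⁻¹ * M₀) * (N₀ + 1) ^ 2 := mul_le_mul hc hsq (by positivity) (by positivity)
      _ ≤ 160 * ‖x‖ * M₀ + 2 * η⁻¹ * M₀ * (N₀ + 1) ^ 2 := by linarith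
  · -- large `n`: `a, b ≥ n/2`, and the mean value bound
    set a : ℝ := ‖(n : ℂ) + x‖ with ha
    set b : ℝ := ‖(-(n : ℂ)) + x‖ with hb
    have hnpos : (0 : ℝ) < n := by rw [hN₀] at hlarge; linarith [norm_nonneg x]
    have ha2 : (n : ℝ) / 2 ≤ a := by
      have : (n : ℝ) - ‖x‖ ≤ a := by
        have h := norm_sub_norm_le (n : ℂ) (-x)
        rw [norm_neg, sub_neg_eq_add, Complex.norm_natCast] at h
        rw [ha]; linarith
      rw [hN₀] at hlarge; linarith
    have hb2 : (n : ℝ) / 2 ≤ b := by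
      have hbn : b = ‖(n : ℂ) - x‖ := by
        rw [hb, ← norm_neg ((n : ℂ) - x)]; congr 1; ring
      have : (n : ℝ) - ‖x‖ ≤ b := by
        have h := norm_sub_norm_le (n : ℂ) x
        rw [Complex.norm_natCast] at h
        rw [hbn]; linarith
      rw [hN₀] at hlarge; linarith
    have ha0 : 0 < a := by linarith
    have hb0 : 0 < b := by linarith
    have haη : η ≤ a := by rw [ha]; simpa using im_le_norm_ofReal_add hx n
    have hbη : η ≤ b := by
      rw [hb]; have := im_le_norm_ofReal_add hx (-(n : ℝ)); simpa using this
    -- `|a - b| ≤ 2‖x‖`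
    have hab : |a - b| ≤ 2 * ‖x‖ := by
      have h := abs_norm_sub_norm_le ((n : ℂ) + x) (-(-(n : ℂ) + x))
      rw [norm_neg] at h
      have : (n : ℂ) + x - -(-(n : ℂ) + x) = 2 * x := by ring
      rw [this, norm_mul, Complex.norm_ofNat] at h
      rw [ha, hb]; exact h
    -- `α, β ≤ M₀`, `|α - β| ≤ 8‖x‖M₀/n`
    set α : ℝ := a ^ (-2 * σ) with hα
    set β : ℝ := b ^ (-2 * σ) with hβ
    have hαM : α ≤ M₀ := rpow_neg_two_mul_le hx haη hσ0 hσ1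
    have hβM : β ≤ M₀ := rpow_neg_two_mul_le hx hbη hσ0 hσ1
    have hα0 : 0 ≤ α := Real.rpow_nonneg ha0.le _
    have hβ0 : 0 ≤ β := Real.rpow_nonneg hb0.le _
    have hdiff : |α - β| ≤ 8 * ‖x‖ * M₀ / n := by
      -- WLOG through `min`
      have key : ∀ {c d : ℝ}, (n : ℝ) / 2 ≤ c → c ≤ d → |d - c| ≤ 2 * ‖x‖ → η ≤ c →
          |d ^ (-2 * σ) - c ^ (-2 * σ)| ≤ 8 * ‖x‖ * M₀ / n := by
        intro c d hc hcd hdc hcη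
        have hc0 : 0 < c := by linarith
        have hmv := abs_rpow_sub_rpow_le hc0 hcd (p := -2 * σ) (by nlinarith)
        have h1 : |(-2 * σ : ℝ)| ≤ 2 := by
          rw [abs_mul, abs_neg, abs_two, abs_of_nonneg hσ0]; linarith
        have h2 : c ^ (-2 * σ - 1) ≤ M₀ * (2 / n) := by
          rw [show (-2 * σ - 1) = (-2 * σ) + (-1 : ℝ) by ring, Real.rpow_add hc0, Real.rpow_neg_one]
          refine mul_le_mul (rpow_neg_two_mul_le hx hcη hσ0 hσ1) ?_ (inv_nonneg.mpr hc0.le)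
            (by linarith)
          calc c⁻¹ ≤ ((n : ℝ) / 2)⁻¹ := inv_anti₀ (by positivity) hc
            _ = 2 / n := inv_div _ _
        have h3 : d - c ≤ 2 * ‖x‖ := (le_abs_self _).trans hdc
        calc |d ^ (-2 * σ) - c ^ (-2 * σ)| ≤ |(-2 * σ : ℝ)| * c ^ (-2 * σ - 1) * (d - c) := hmv
          _ ≤ 2 * (M₀ * (2 / n)) * (2 * ‖x‖) := by
              refine mul_le_mul (mul_le_mul h1 h2 (Real.rpow_nonneg hc0.le _) (by norm_num)) h3
                (by linarith) (by positivity)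
          _ = 8 * ‖x‖ * M₀ / n := by ring
      rcases le_or_gt a b with h | h
      · have := key ha2 h (by rwa [abs_sub_comm]) haη
        rwa [abs_sub_comm] at this
      · exact key hb2 h.le (by simpa using hab) hbη
    -- assemble with the closed form
    rw [rowKernel_pair_eq hx σ n]
    have hxn : x ^ 2 - (n : ℂ) ^ 2 = ((n : ℂ) + x) * (-(n : ℂ) + x) := by ring
    have hden : ‖x ^ 2 - (n : ℂ) ^ 2‖ = a * b := by rw [hxn, norm_mul, ha, hb]
    rw [norm_div, hden, div_le_div_iff₀ (mul_pos ha0 hb0) (by positivity)]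
    have hnum : ‖x * ((α : ℂ) + (β : ℂ)) - n * ((α : ℂ) - (β : ℂ))‖ ≤
        2 * ‖x‖ * M₀ + 8 * ‖x‖ * M₀ := by
      calc _ ≤ ‖x * ((α : ℂ) + (β : ℂ))‖ + ‖(n : ℂ) * ((α : ℂ) - (β : ℂ))‖ := norm_sub_le _ _
        _ = ‖x‖ * |α + β| + n * |α - β| := by
            rw [norm_mul, norm_mul, Complex.norm_natCast, ← ofReal_add, ← ofReal_sub,
              Complex.norm_real, Complex.norm_real, Real.norm_eq_abs, Real.norm_eq_abs]
        _ ≤ ‖x‖ * (2 * M₀) + n * (8 * ‖x‖ * M₀ / n) := by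
            refine add_le_add (mul_le_mul_of_nonneg_left ?_ (norm_nonneg _))
              (mul_le_mul_of_nonneg_left hdiff hnpos.le)
            rw [abs_of_nonneg (by positivity)]; linarith
        _ = 2 * ‖x‖ * M₀ + 8 * ‖x‖ * M₀ := by field_simp
    have hab4 : ((n : ℝ) + 1) ^ 2 ≤ 16 * (a * b) := by
      have : ((n : ℝ) + 1) ^ 2 ≤ 4 * (n : ℝ) ^ 2 := by
        have : (1 : ℝ) ≤ n := by
          rw [hN₀] at hlarge; linarith [norm_nonneg x]
        nlinarith
      nlinarith [mul_le_mul ha2 hb2 (by positivity) ha0.le]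
    calc ‖x * ((α : ℂ) + (β : ℂ)) - n * ((α : ℂ) - (β : ℂ))‖ * ((n : ℝ) + 1) ^ 2
        ≤ (2 * ‖x‖ * M₀ + 8 * ‖x‖ * M₀) * (16 * (a * b)) :=
          mul_le_mul hnum hab4 (by positivity) (by positivity)
      _ = (160 * ‖x‖ * M₀) * (a * b) := by ring
      _ ≤ (160 * ‖x‖ * M₀ + 2 * η⁻¹ * M₀ * (N₀ + 1) ^ 2) * (a * b) :=
          mul_le_mul_of_nonneg_right (by linarith) (by positivity)

/-! ### The limit -/

omit hx in
/-- A complex number with non-zero imaginary part is not an integer. [folklore] -/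
theorem mem_integerComplement_of_im_ne_zero {z : ℂ} (hz : z.im ≠ 0) :
    z ∈ Complex.integerComplement := by
  rintro ⟨n, rfl⟩
  exact hz (Complex.intCast_im n)

/-- `∑_{n ∈ ℕ} [(x+n)⁻¹ + (x-n)⁻¹] = π cot(πx) + x⁻¹` (Mathlib's `cot_series_rep` plus the `n = 0`
term). [folklore] -/
theorem tsum_inv_add_inv_sub_eq :
    ∑' n : ℕ, (((n : ℂ) + x)⁻¹ + (-(n : ℂ) + x)⁻¹) = π * Complex.cot (π * x) + x⁻¹ := by
  have hx' : x ∈ Complex.integerComplement := mem_integerComplement_of_im_ne_zero hx.ne'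
  have hcot := cot_series_rep hx'
  -- the `ℕ+`-sum of Mathlib as a shifted `ℕ`-sum
  have hsucc : ∑' n : ℕ+, (1 / (x - n) + 1 / (x + n)) =
      ∑' n : ℕ, (1 / (x - (n + 1)) + 1 / (x + (n + 1))) := by
    have := tsum_pnat_eq_tsum_succ (f := fun n : ℕ ↦ (1 / (x - n) + 1 / (x + n)))
    simpa using this
  have hsum : Summable fun n : ℕ ↦ (1 / (x - (n + 1)) + 1 / (x + (n + 1))) := summable_cotTerm hx'
  -- our summand, shifted by one, is Mathlib's `cotTerm`
  have hF : ∀ n : ℕ, (((n : ℂ) + x)⁻¹ + (-(n : ℂ) + x)⁻¹) = (1 / (x - n) + 1 / (x + n)) := by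
    intro n
    rw [one_div, one_div, add_comm ((n : ℂ) + x)⁻¹]
    congr 1 <;> ring_nf
  simp_rw [hF]
  have hsum' : Summable fun n : ℕ ↦ (1 / (x - n) + 1 / (x + n)) := by
    rw [← summable_nat_add_iff 1]
    simpa using hsum
  rw [hsum'.tsum_eq_zero_add]
  simp only [Nat.cast_zero, sub_zero, add_zero, Nat.cast_add, Nat.cast_one]
  rw [← hsucc, hcot]
  ring

/-- **Hecke's limit formula**: for `Im x > 0`,
`∑_{δ ∈ ℤ} (x + δ)⁻¹ |x + δ|^{-2σ} → π cot(πx)` as `σ → 0⁺` (pairing `δ ↔ -δ`, Tannery's theorem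
with the domination `norm_rowKernel_pair_le`, and the partial fractions of the cotangent)
(Hecke 1927, §2; Schoeneberg VII §2 (14)). [folklore] -/
theorem tendsto_tsum_rowKernel_int_nhdsGT_zero :
    Tendsto (fun σ : ℝ ↦ ∑' δ : ℤ, rowKernel x σ δ) (𝓝[>] 0) (𝓝 (π * Complex.cot (π * x))) := by
  -- pairing: for `σ > 0` the `ℤ`-sum is `∑_{n ∈ ℕ} [k(n) + k(-n)] - k(0)`
  have hpair : ∀ σ : ℝ, 0 < σ → ∑' δ : ℤ, rowKernel x σ δ =
      ∑' n : ℕ, (rowKernel x σ n + rowKernel x σ (-(n : ℝ))) - rowKernel x σ 0 := by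
    intro σ hσ
    have hs : Summable fun δ : ℤ ↦ rowKernel x σ δ :=
      (summable_norm_rowKernel_int hx (s := (σ : ℂ)) (by simpa using hσ)).of_norm
    have h := hs.hasSum.nat_add_neg
    simp only [Int.cast_natCast, Int.cast_neg, Int.cast_zero] at h
    rw [h.tsum_eq]
    simp
  -- Tannery
  obtain ⟨K, hK⟩ := norm_rowKernel_pair_le hx
  have hbound_sum : Summable fun n : ℕ ↦ K / ((n : ℝ) + 1) ^ 2 := by
    have := (Real.summable_one_div_nat_add_rpow 1 2).mpr one_lt_two
    refine (this.mul_left K).congr fun n ↦ ?_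
    rw [abs_of_pos (by positivity), Real.rpow_two]
    ring
  have hlim : ∀ n : ℕ, Tendsto (fun σ : ℝ ↦ rowKernel x σ n + rowKernel x σ (-(n : ℝ))) (𝓝[>] 0)
      (𝓝 (((n : ℂ) + x)⁻¹ + (-(n : ℂ) + x)⁻¹)) := by
    intro n
    have h1 := (tendsto_rowKernel_nhds_zero hx n).mono_left (nhdsWithin_le_nhds (s := Ioi 0))
    have h2 := (tendsto_rowKernel_nhds_zero hx (-(n : ℝ))).mono_left
      (nhdsWithin_le_nhds (s := Ioi 0))
    simp only [ofReal_natCast] at h1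
    simp only [ofReal_neg, ofReal_natCast] at h2
    exact h1.add h2
  have hev : ∀ᶠ σ : ℝ in 𝓝[>] 0, ∀ n : ℕ,
      ‖rowKernel x σ n + rowKernel x σ (-(n : ℝ))‖ ≤ K / ((n : ℝ) + 1) ^ 2 := by
    filter_upwards [Ioo_mem_nhdsGT (show (0 : ℝ) < 1 from one_pos)] with σ hσ
    exact hK σ hσ.1.le hσ.2.le
  have hT := tendsto_tsum_of_dominated_convergence hbound_sum hlim hev
  rw [tsum_inv_add_inv_sub_eq hx] at hT
  -- the `k(0)` term
  have h0 : Tendsto (fun σ : ℝ ↦ rowKernel x σ 0) (𝓝[>] 0) (𝓝 x⁻¹) := by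
    have := (tendsto_rowKernel_nhds_zero hx 0).mono_left (nhdsWithin_le_nhds (s := Ioi 0))
    simpa using this
  have hfinal := hT.sub h0
  rw [show π * Complex.cot (π * x) + x⁻¹ - x⁻¹ = π * Complex.cot (π * x) by ring] at hfinal
  refine hfinal.congr' ?_
  filter_upwards [self_mem_nhdsWithin] with σ hσ
  exact (hpair σ hσ).symm

end RealSigma

/-! ### Splitting an absolutely convergent `ℤ`-sum into residue classes -/

section Classes

variable {P : ℕ} (hP : 0 < P)
include hP

/-- `(r, δ) ↦ r + Pδ` is a bijection `Fin P × ℤ → ℤ` (division with remainder). [folklore] -/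
theorem bijective_fin_add_mul :
    Function.Bijective (fun p : Fin P × ℤ ↦ ((p.1 : ℕ) : ℤ) + (P : ℤ) * p.2) := by
  have hP' : (P : ℤ) ≠ 0 := by exact_mod_cast hP.ne'
  constructor
  · rintro ⟨r, δ⟩ ⟨r', δ'⟩ h
    simp only at h
    have h1 : (((r : ℕ) : ℤ) + (P : ℤ) * δ) % (P : ℤ) =
        (((r' : ℕ) : ℤ) + (P : ℤ) * δ') % (P : ℤ) := by
      rw [h]
    rw [Int.add_mul_emod_self_left, Int.add_mul_emod_self_left,
      Int.emod_eq_of_lt (by positivity) (by exact_mod_cast r.2),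
      Int.emod_eq_of_lt (by positivity) (by exact_mod_cast r'.2)] at h1
    have hr : r = r' := Fin.ext (by exact_mod_cast h1)
    subst hr
    have h2 : (P : ℤ) * δ = (P : ℤ) * δ' := by linarith
    rw [mul_left_cancel₀ hP' h2]
  · intro d
    have h0 : 0 ≤ d % (P : ℤ) := Int.emod_nonneg d hP'
    have h1 : d % (P : ℤ) < P := Int.emod_lt_of_pos d (by exact_mod_cast hP)
    refine ⟨(⟨(d % (P : ℤ)).toNat, by omega⟩, d / P), ?_⟩
    simp only
    rw [show (((d % (P : ℤ)).toNat : ℕ) : ℤ) = d % (P : ℤ) from Int.toNat_of_nonneg h0]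
    exact Int.emod_add_mul_ediv d P

/-- **Residue classes**: `∑_{d ∈ ℤ} F(d) = ∑_{r mod P} ∑_{δ ∈ ℤ} F(r + Pδ)` for a summable `F`.
[folklore] -/
theorem tsum_int_eq_sum_tsum_classes {F : ℤ → ℂ} (hF : Summable F) :
    ∑' d : ℤ, F d = ∑ r : Fin P, ∑' δ : ℤ, F (((r : ℕ) : ℤ) + (P : ℤ) * δ) := by
  set e := Equiv.ofBijective _ (bijective_fin_add_mul hP) with he
  rw [← e.tsum_eq F]
  have hF' : Summable (fun p : Fin P × ℤ ↦ F (e p)) := (e.summable_iff).mpr hF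
  rw [hF'.tsum_prod, tsum_fintype]
  rfl

end Classes

/-! ### The value of the continued row at `s = 0` -/

section RowValue

/-- `(r z)ᵃ = rᵃ zᵃ` for real `r > 0` and `z ≠ 0` (the arguments add without wrapping). A private
copy of `Literature.NumberTheory.LFunctions.AFE.ofReal_mul_cpow` (`AFECoefficient.lean`), kept
local to avoid that file's `import Mathlib`. [folklore] -/
private theorem ofReal_mul_cpow_of_pos {r : ℝ} (hr : 0 < r) {z : ℂ} (hz : z ≠ 0) (a : ℂ) :
    ((r : ℂ) * z) ^ a = (r : ℂ) ^ a * z ^ a := by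
  have hr0 : (r : ℂ) ≠ 0 := by exact_mod_cast hr.ne'
  rw [cpow_def_of_ne_zero (mul_ne_zero hr0 hz), cpow_def_of_ne_zero hr0, cpow_def_of_ne_zero hz,
    Complex.log_ofReal_mul hr hz, add_mul, Complex.exp_add, Complex.ofReal_log hr.le]

/-- `(P z)ᵃ = Pᵃ zᵃ` for a positive natural number `P` and `z ≠ 0`. [folklore] -/
theorem natCast_mul_cpow_of_pos {P : ℕ} (hP : 0 < P) {z : ℂ} (hz : z ≠ 0) (a : ℂ) :
    ((P : ℂ) * z) ^ a = (P : ℂ) ^ a * z ^ a := by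
  have h := ofReal_mul_cpow_of_pos (show (0 : ℝ) < P by exact_mod_cast hP) hz a
  simpa only [Complex.ofReal_natCast] using h

variable {P : ℕ} (hP : 0 < P) {w : ℂ} (hw : 0 < w.im)
include hP hw

/-- The class points `(w + r)/P` lie in the upper half-plane. [folklore] -/
theorem im_class_pos (r : ℤ) : 0 < ((w + r) / P).im := by
  have hP' : (0 : ℝ) < P := by exact_mod_cast hP
  rw [Complex.div_natCast_im]
  simp only [add_im, intCast_im, add_zero]
  exact div_pos hw hP'

/-- **Scaling to the class point**: `k(w, s; r + Pδ) = P^{-1-2s} k((w + r)/P, s; δ)`. [folklore] -/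
theorem rowKernel_class_eq (s : ℂ) (r δ : ℤ) :
    rowKernel w s ((r + (P : ℤ) * δ : ℤ) : ℝ) =
      (P : ℂ) ^ (-1 - 2 * s) * rowKernel ((w + r) / P) s δ := by
  have hP0 : (P : ℂ) ≠ 0 := by exact_mod_cast hP.ne'
  have hx := im_class_pos hP hw r
  have hA : (δ : ℂ) + (w + r) / P ≠ 0 := by
    simpa using ofReal_add_ne_zero hx δ
  have hB : (δ : ℂ) + conj ((w + r) / P) ≠ 0 := by
    simpa using ofReal_add_conj_ne_zero hx δ
  unfold rowKernel
  have e1 : (((r + (P : ℤ) * δ : ℤ) : ℝ) : ℂ) + w = (P : ℂ) * ((δ : ℂ) + (w + r) / P) := by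
    push_cast
    field_simp
    ring
  have e2 : (((r + (P : ℤ) * δ : ℤ) : ℝ) : ℂ) + conj w =
      (P : ℂ) * ((δ : ℂ) + conj ((w + r) / P)) := by
    rw [map_div₀, map_add, map_natCast, map_intCast]
    push_cast
    field_simp
    ring
  rw [e1, e2, natCast_mul_cpow_of_pos hP hA, natCast_mul_cpow_of_pos hP hB,
    show (-1 - 2 * s) = (-1 - s) + (-s) by ring, cpow_add _ _ hP0]
  push_cast
  ring

omit hw in
/-- A `P`-periodic weight is bounded by `∑_{i mod P} ‖χ i‖`. [folklore] -/
theorem norm_le_sum_of_periodic {χ : ℤ → ℂ} (hχ : Function.Periodic χ (P : ℤ)) (d : ℤ) :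
    ‖χ d‖ ≤ ∑ i ∈ Finset.range P, ‖χ i‖ := by
  have hP' : (P : ℤ) ≠ 0 := by exact_mod_cast hP.ne'
  have h0 : 0 ≤ d % (P : ℤ) := Int.emod_nonneg d hP'
  have h1 : d % (P : ℤ) < P := Int.emod_lt_of_pos d (by exact_mod_cast hP)
  have hmem : (d % (P : ℤ)).toNat ∈ Finset.range P := by
    rw [Finset.mem_range]; omega
  have heq : χ d = χ ((d % (P : ℤ)).toNat : ℕ) := by
    rw [show (((d % (P : ℤ)).toNat : ℕ) : ℤ) = d % (P : ℤ) from Int.toNat_of_nonneg h0]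
    exact (PeriodicAbel.apply_emod_eq hχ d).symm
  rw [heq]
  exact Finset.single_le_sum (f := fun i : ℕ ↦ ‖χ i‖) (fun _ _ ↦ norm_nonneg _) hmem

/-- **The row as a sum of scaled class rows** (`Re s > 0`):
`R(χ, w, s) = ∑_{r mod P} χ(r) P^{-1-2s} ∑_{δ ∈ ℤ} k((w+r)/P, s; δ)`. [folklore] -/
theorem rowSum_eq_sum_classes {χ : ℤ → ℂ} (hχ : Function.Periodic χ (P : ℤ)) {s : ℂ}
    (hs : 0 < s.re) :
    rowSum χ w s = ∑ r : Fin P, χ r *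
      ((P : ℂ) ^ (-1 - 2 * s) * ∑' δ : ℤ, rowKernel ((w + ((r : ℕ) : ℤ)) / P) s δ) := by
  unfold rowSum
  have hF : Summable fun d : ℤ ↦ χ d * rowKernel w s d :=
    (summable_norm_mul_rowKernel_int hw (norm_le_sum_of_periodic hP hχ) hs).of_norm
  rw [tsum_int_eq_sum_tsum_classes hP hF]
  refine Finset.sum_congr rfl fun r _ ↦ ?_
  rw [← tsum_mul_left, ← tsum_mul_left]
  refine tsum_congr fun δ ↦ ?_
  have hper : χ (((r : ℕ) : ℤ) + (P : ℤ) * δ) = χ r := by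
    rw [mul_comm]
    exact (hχ.int_mul δ) _
  rw [hper, rowKernel_class_eq hP hw s ((r : ℕ) : ℤ) δ]

/-- **The value of the continued row at `s = 0`**:
`R̃(χ, w, 0) = ∑_{r mod P} χ(r) (π/P) cot(π (w + r)/P)` for a `P`-periodic `χ` of mean zero
(`R = R̃` on `Re s > 0`, continuity of `R̃` at `0`, and Hecke's limit formula class by class).
[folklore] -/
theorem rowCont_zero_eq {χ : ℤ → ℂ} (hχ : Function.Periodic χ (P : ℤ))
    (hmean : ∑ i ∈ Finset.range P, χ i = 0) :
    rowCont P χ w 0 = ∑ r : Fin P, χ r *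
      ((π / P) * Complex.cot (π * ((w + ((r : ℕ) : ℤ)) / P))) := by
  have hP0 : (P : ℂ) ≠ 0 := by exact_mod_cast hP.ne'
  -- the two real-variable functions agreeing on `σ > 0`
  set f : ℝ → ℂ := fun σ ↦ rowCont P χ w σ with hf
  set g : ℝ → ℂ := fun σ ↦ ∑ r : Fin P, χ r *
    ((P : ℂ) ^ (-1 - 2 * (σ : ℂ)) * ∑' δ : ℤ, rowKernel ((w + ((r : ℕ) : ℤ)) / P) σ δ) with hg
  have hfg : ∀ σ : ℝ, 0 < σ → f σ = g σ := by
    intro σ hσ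
    have hs : 0 < (σ : ℂ).re := by simpa using hσ
    simp only [hf, hg]
    rw [← rowSum_eq_rowCont hP hχ hmean hw hs, rowSum_eq_sum_classes hP hw hχ hs]
  -- limit of `f`
  have hfl : Tendsto f (𝓝[>] 0) (𝓝 (rowCont P χ w 0)) := by
    have h1 : ContinuousAt (rowCont P χ w) ((0 : ℝ) : ℂ) :=
      continuousAt_rowCont hP χ hw (by simp)
    have h2 : Tendsto (fun σ : ℝ ↦ (σ : ℂ)) (𝓝 0) (𝓝 ((0 : ℝ) : ℂ)) :=
      continuous_ofReal.continuousAt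
    have h3 := h1.tendsto.comp h2
    simp only [ofReal_zero] at h3
    exact h3.mono_left nhdsWithin_le_nhds
  -- limit of `g`
  have hpow : Tendsto (fun σ : ℝ ↦ (P : ℂ) ^ (-1 - 2 * (σ : ℂ))) (𝓝[>] 0) (𝓝 ((P : ℂ)⁻¹)) := by
    have h1 : ContinuousAt (fun u : ℂ ↦ (P : ℂ) ^ u) (-1) := continuousAt_const_cpow hP0
    have h2 : Tendsto (fun σ : ℝ ↦ -1 - 2 * (σ : ℂ)) (𝓝 0) (𝓝 (-1)) := by
      have : Continuous fun σ : ℝ ↦ -1 - 2 * (σ : ℂ) := by fun_prop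
      simpa using this.tendsto 0
    have h3 := h1.tendsto.comp h2
    rw [cpow_neg_one] at h3
    exact h3.mono_left nhdsWithin_le_nhds
  have hgl : Tendsto g (𝓝[>] 0) (𝓝 (∑ r : Fin P, χ r *
      ((P : ℂ)⁻¹ * (π * Complex.cot (π * ((w + ((r : ℕ) : ℤ)) / P)))))) := by
    refine tendsto_finsetSum _ fun r _ ↦ Tendsto.const_mul _ (hpow.mul ?_)
    exact tendsto_tsum_rowKernel_int_nhdsGT_zero (im_class_pos hP hw ((r : ℕ) : ℤ))
  -- uniqueness of the limit
  have hfl' : Tendsto f (𝓝[>] 0) (𝓝 (∑ r : Fin P, χ r *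
      ((P : ℂ)⁻¹ * (π * Complex.cot (π * ((w + ((r : ℕ) : ℤ)) / P)))))) :=
    hgl.congr' (by
      filter_upwards [self_mem_nhdsWithin] with σ hσ
      exact (hfg σ hσ).symm)
  have h := tendsto_nhds_unique hfl hfl'
  rw [h]
  refine Finset.sum_congr rfl fun r _ ↦ ?_
  rw [div_eq_mul_inv]
  ring

end RowValue

end Literature.NumberTheory.EllipticCurves.ModularForms
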